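import Literature.MathematicalPhysics.QuantumFieldTheory.Balaban1983to89.LatticeWordStokes
import HarnessLib

/-!
# Route `SmallFieldWidening`, crux r3 `LargeFieldMassRefinementTail` (stmt-QuantumFields-22884) — support file:
# THE CRUDE NON-ABELIAN LATTICE STOKES BOUND FOR CLOSED WORDS UNDER A **LOCAL** SMALL-FIELD HYPOTHESIS

Width seat `ym-line-sfw-p2-w2` (gen 47).  WHY.  The (base) conjunct of the registered stub `stub_localStepFloor` of line `birth`
(the unit-plaquette tail of the block-averaged field at a FIXED run, uniformly in the VOLUME of the family) is discharged by a
union bound over the finitely many fine plaquettes NEAR the unit plaquette, which needs «averages of locally small fields have a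
small plaquette THERE» — the tree's `LatticeWordStokes` / `BlockAveragingPlaquetteBound` carry the GLOBAL hypothesis
`PlaqSmall δ U` (every plaquette of the torus), which a volume-uniform union bound cannot afford.  This module re-proves
`LatticeWordStokes` §§2–6 VERBATIM IN METHOD under the local hypothesis

  `∀ u, |u| ≤ r → every plaquette with lower-left corner walkEnd x u is within δ of 1`

(all plaquettes whose corner is reachable from the base site `x` by a lattice word of length `≤ r`): the adjacent-transposition /
backtrack-cancellation calculus only ever meets plaquettes cornered at `walkEnd x u`, `|u| ≤ |w|`, for a closed word `w` based at `x`.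
* §1 the commutator defect of two letters at `y` is within `δ` of `1` if the plaquettes cornered at `walkEnd y v`, `|v| ≤ 2`, are;
* §2 adjacent transpositions behind a prefix `A` cost one such plaquette (`|A| + 2 ≤ r`); backtracks are free; moving a letter to its
  partner through `B` costs `|B|·δ` (`|A| + |B| + 2 ≤ r`);
* §3 **`dist1_holAt_le_loc`**: `|𝒰_x(w) − 1| ≤ (|w|²/4)·δ` for every closed word `w` (`netDisp w = 0`) of length `≤ r`;
* §4 the (0.4) loop variables at a coarse bond `c` (closed words of length `≤ (d+2)L` from `emb c₋`): **`dist1_loopHol_le_loc`**,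
  **`small_loc`** (the guard `BlockAveraging.Small ℰ U c` from the local hypothesis at `emb c₋` with radius `(d+2)L`).
Nothing here is new mathematics ([Balaban1985Averaging] (19)–(20); the tree file's argument); the point is the hypothesis.
No summit is proved by this file (rung R3 is a RECORD rung; the YM mass gap is NOT proved by any of this).
-/

namespace Summit.QuantumFields.YangMills.Theorems.LocalWordStokes

open Literature.MathematicalPhysics.QuantumFieldTheory.Balaban1983to89
open Literature.MathematicalPhysics.QuantumFieldTheory.Balaban1983to89.T4Continuum
open Literature.MathematicalPhysics.QuantumFieldTheory.Balaban1983to89.T4ReflectionCone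
open Literature.MathematicalPhysics.QuantumFieldTheory.Balaban1983to89.LatticeWordStokes

variable {P : Params} {j : ℕ} {G : Type*} [GaugeGroup G]

/-! ## §1 The commutator defect under the local hypothesis at its own base -/

section Defect

variable (U : GaugeField P j G)

/-- **THE COMMUTATOR DEFECT, ORDERED NON-PARALLEL CASE, LOCAL FORM** (`a < b`): if every plaquette cornered at `walkEnd y v`,
`|v| ≤ 2`, is within `δ` of `1`, then `𝒰_y((a,s)(b,t))·𝒰_y((b,t)(a,s))⁻¹` is within `δ` of `1` (it is a conjugate of the plaquette
variable at `y`, `y − e_a`, `y − e_b` or `y − e_a − e_b`, or of its inverse). [cite: Balaban1985Averaging, (9) p.19 and (19)-(20) p.21] -/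
theorem dist1_swapDefect_lt_of_lt_loc {δ : ℝ} (y : Site P j)
    (hy : ∀ v : List (Letter P.d), v.length ≤ 2 → ∀ (a b : Fin P.d) (hab : a < b),
      dist1 (GaugeField.plaqHol U ⟨walkEnd y v, a, b, hab⟩) < δ)
    {a b : Fin P.d} (hab : a < b) (s t : Bool) :
    dist1 (holAt U (walk y [(a, s), (b, t)]) * (holAt U (walk y [(b, t), (a, s)]))⁻¹) < δ := by
  cases s <;> cases t
  · -- (−a, −b): plaquette at z = y − a − b
    have hp : dist1 (GaugeField.plaqHol U ⟨(y.unshift a).unshift b, a, b, hab⟩) < δ :=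
      hy [(a, false), (b, false)] (by simp) a b hab
    refine dist1_conj_lt (U ⟨(y.unshift a).unshift b, a⟩ * U ⟨((y.unshift a).unshift b).shift a, b⟩)⁻¹ hp (Or.inl ?_)
    rw [holAt_walk_ff, holAt_walk_ff]
    simp only [GaugeField.plaqHol]
    have h1 : (y.unshift b).unshift a = (y.unshift a).unshift b := by
      funext i
      by_cases ha : i = a <;> by_cases hb : i = b
      · subst ha; subst hb; rfl
      · subst ha; simp [Site.unshift, hb]
      · subst hb; simp [Site.unshift, ha]
      · simp [Site.unshift, ha, hb]
    have h2 : ((y.unshift a).unshift b).shift b = y.unshift a := Site.shift_unshift _ _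
    have h3 : ((y.unshift a).unshift b).shift a = y.unshift b := by rw [← h1, Site.shift_unshift]
    rw [h1, h2, h3]
    group
  · -- (−a, +b): plaquette at z = y − a
    have hp : dist1 (GaugeField.plaqHol U ⟨y.unshift a, a, b, hab⟩) < δ := hy [(a, false)] (by simp) a b hab
    refine dist1_conj_lt (U ⟨y.unshift a, a⟩)⁻¹ hp (Or.inr ?_)
    rw [holAt_walk_ft, holAt_walk_tf]
    simp only [GaugeField.plaqHol]
    have h1 : (y.unshift a).shift a = y := Site.shift_unshift _ _
    have h2 : (y.shift b).unshift a = (y.unshift a).shift b := by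
      funext i
      by_cases ha : i = a <;> by_cases hb : i = b
      · exact absurd (ha.symm.trans hb) (ne_of_lt hab)
      · subst ha; simp [Site.shift, Site.unshift, hb]
      · subst hb; simp [Site.shift, Site.unshift, ha]
      · simp [Site.shift, Site.unshift, ha, hb]
    rw [h1, h2]
    group
  · -- (+a, −b): plaquette at z = y − b
    have hp : dist1 (GaugeField.plaqHol U ⟨y.unshift b, a, b, hab⟩) < δ := hy [(b, false)] (by simp) a b hab
    refine dist1_conj_lt (U ⟨y.unshift b, b⟩)⁻¹ hp (Or.inr ?_)
    rw [holAt_walk_tf, holAt_walk_ft]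
    simp only [GaugeField.plaqHol]
    have h1 : (y.unshift b).shift b = y := Site.shift_unshift _ _
    have h2 : (y.shift a).unshift b = (y.unshift b).shift a := by
      funext i
      by_cases ha : i = a <;> by_cases hb : i = b
      · exact absurd (ha.symm.trans hb) (ne_of_lt hab)
      · subst ha; simp [Site.shift, Site.unshift, hb]
      · subst hb; simp [Site.shift, Site.unshift, ha]
      · simp [Site.shift, Site.unshift, ha, hb]
    rw [h1, h2]
    group
  · -- (+a, +b): the plaquette at y itself
    have hp : dist1 (GaugeField.plaqHol U ⟨y, a, b, hab⟩) < δ := hy [] (by simp) a b hab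
    refine dist1_conj_lt 1 hp (Or.inl ?_)
    rw [holAt_walk_tt, holAt_walk_tt]
    simp only [GaugeField.plaqHol]
    group

/-- **THE COMMUTATOR DEFECT OF ANY TWO LETTERS, LOCAL FORM**: within `δ ≥ 0` of `1` if the plaquettes cornered at `walkEnd y v`,
`|v| ≤ 2`, are. [cite: Balaban1985Averaging, (9) p.19 and (19)-(20) p.21] -/
theorem dist1_swapDefect_le_loc {δ : ℝ} (hδ : 0 ≤ δ) (y : Site P j)
    (hy : ∀ v : List (Letter P.d), v.length ≤ 2 → ∀ (a b : Fin P.d) (hab : a < b),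
      dist1 (GaugeField.plaqHol U ⟨walkEnd y v, a, b, hab⟩) < δ)
    (m₁ m₂ : Letter P.d) :
    dist1 (holAt U (walk y [m₁, m₂]) * (holAt U (walk y [m₂, m₁]))⁻¹) ≤ δ := by
  obtain ⟨a, s⟩ := m₁
  obtain ⟨b, t⟩ := m₂
  rcases lt_trichotomy a b with hab | rfl | hba
  · exact (dist1_swapDefect_lt_of_lt_loc U y hy hab s t).le
  · rw [swapDefect_eq_one_of_parallel, GaugeGroup.dist1_one]; exact hδ
  · have hsymm : holAt U (walk y [(a, s), (b, t)]) * (holAt U (walk y [(b, t), (a, s)]))⁻¹ =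
        (holAt U (walk y [(b, t), (a, s)]) * (holAt U (walk y [(a, s), (b, t)]))⁻¹)⁻¹ := by group
    rw [hsymm, GaugeGroup.dist1_inv]
    exact (dist1_swapDefect_lt_of_lt_loc U y hy hba t s).le

end Defect

/-! ## §2 Transpositions and cancellations behind a prefix, under the local hypothesis at the base -/

section Swap

variable (U : GaugeField P j G)

/-- The local hypothesis at `x` with radius `r` restricts to the local hypothesis at `walkEnd x A` with radius `2` once
`|A| + 2 ≤ r` (concatenate the words). [folklore] -/
theorem loc_at_walkEnd {δ : ℝ} {x : Site P j} {r : ℕ}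
    (hU : ∀ u : List (Letter P.d), u.length ≤ r → ∀ (a b : Fin P.d) (hab : a < b),
      dist1 (GaugeField.plaqHol U ⟨walkEnd x u, a, b, hab⟩) < δ)
    (A : List (Letter P.d)) (hA : A.length + 2 ≤ r) :
    ∀ v : List (Letter P.d), v.length ≤ 2 → ∀ (a b : Fin P.d) (hab : a < b),
      dist1 (GaugeField.plaqHol U ⟨walkEnd (walkEnd x A) v, a, b, hab⟩) < δ := by
  intro v hv a b hab
  rw [← walkEnd_append]
  exact hU (A ++ v) (by rw [List.length_append]; omega) a b hab

/-- **AN ADJACENT TRANSPOSITION BEHIND A PREFIX `A` COSTS AT MOST `δ`, LOCAL FORM** (`|A| + 2 ≤ r`, `δ ≥ 0`).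
[cite: Balaban1985Averaging, (19)-(20) p.21] -/
theorem dist1_holAt_swap_le_loc {δ : ℝ} (hδ : 0 ≤ δ) {x : Site P j} {r : ℕ}
    (hU : ∀ u : List (Letter P.d), u.length ≤ r → ∀ (a b : Fin P.d) (hab : a < b),
      dist1 (GaugeField.plaqHol U ⟨walkEnd x u, a, b, hab⟩) < δ)
    (A C : List (Letter P.d)) (m₁ m₂ : Letter P.d) (hA : A.length + 2 ≤ r) :
    dist1 (holAt U (walk x (A ++ m₁ :: m₂ :: C))) ≤ δ + dist1 (holAt U (walk x (A ++ m₂ :: m₁ :: C))) := by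
  rw [holAt_walk_swap_eq U x A C m₁ m₂]
  refine (GaugeGroup.dist1_mul_le _ _).trans ?_
  rw [GaugeGroup.dist1_conj]
  exact add_le_add (dist1_swapDefect_le_loc U hδ _ (loc_at_walkEnd U hU A hA) m₁ m₂) le_rfl

/-- **MOVING `m̄` LEFTWARD THROUGH `B` TO ITS PARTNER COSTS `|B|` PLAQUETTES, LOCAL FORM** (`|A| + |B| + 2 ≤ r`):
`|𝒰_x(A m B m̄ C) − 1| ≤ |B|·δ + |𝒰_x(A B C) − 1|`. [cite: Balaban1985Averaging, (19)-(20) p.21] -/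
theorem dist1_holAt_cancel_le_loc {δ : ℝ} (hδ : 0 ≤ δ) {x : Site P j} {r : ℕ}
    (hU : ∀ u : List (Letter P.d), u.length ≤ r → ∀ (a b : Fin P.d) (hab : a < b),
      dist1 (GaugeField.plaqHol U ⟨walkEnd x u, a, b, hab⟩) < δ)
    (m : Letter P.d) :
    ∀ (B A C : List (Letter P.d)), A.length + B.length + 2 ≤ r →
      dist1 (holAt U (walk x (A ++ m :: (B ++ m.flip :: C)))) ≤ (B.length : ℝ) * δ + dist1 (holAt U (walk x (A ++ (B ++ C))))
  | [], A, C, _ => by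
    simp only [List.nil_append, List.length_nil, Nat.cast_zero, zero_mul, zero_add]
    rw [holAt_walk_backtrack]
  | b :: B, A, C, hlen => by
    have h₁ : A ++ b :: m :: (B ++ m.flip :: C) = (A ++ [b]) ++ m :: (B ++ m.flip :: C) := by simp
    have h₂ : A ++ (b :: B ++ C) = (A ++ [b]) ++ (B ++ C) := by simp
    have hA : A.length + 2 ≤ r := by simp only [List.length_cons] at hlen; omega
    have hA' : (A ++ [b]).length + B.length + 2 ≤ r := by
      simp only [List.length_cons, List.length_append, List.length_nil] at hlen ⊢; omega
    calc dist1 (holAt U (walk x (A ++ m :: (b :: B ++ m.flip :: C))))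
        ≤ δ + dist1 (holAt U (walk x (A ++ b :: m :: (B ++ m.flip :: C)))) := dist1_holAt_swap_le_loc U hδ hU A _ m b hA
      _ ≤ δ + ((B.length : ℝ) * δ + dist1 (holAt U (walk x (A ++ (b :: B ++ C))))) := by
          rw [h₁, h₂]
          exact add_le_add le_rfl (dist1_holAt_cancel_le_loc hδ hU m B (A ++ [b]) C hA')
      _ = ((b :: B).length : ℝ) * δ + dist1 (holAt U (walk x (A ++ (b :: B ++ C)))) := by
          simp only [List.length_cons, Nat.cast_succ]
          ring

end Swap

/-! ## §3 The bound for closed words under the local hypothesis -/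

section Main

variable (U : GaugeField P j G)

/-- A word with positive net displacement in direction `a` contains the letter `+e_a`; with negative, the letter `−e_a`. [folklore] -/
private theorem mem_of_netDisp_ne (a : Fin P.d) : ∀ (w : List (Letter P.d)),
    (0 < netDisp w a → (a, true) ∈ w) ∧ (netDisp w a < 0 → (a, false) ∈ w)
  | [] => by simp [netDisp]
  | l :: w => by
    obtain ⟨hpos, hneg⟩ := mem_of_netDisp_ne a w
    obtain ⟨b, s⟩ := l
    constructor
    · intro h
      rw [netDisp_cons] at h
      by_cases hb : b = a
      · subst hb
        cases s
        · exact List.mem_cons_of_mem _ (hpos (by simp at h; linarith))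
        · exact List.mem_cons_self
      · exact List.mem_cons_of_mem _ (hpos (by simp [hb] at h; exact h))
    · intro h
      rw [netDisp_cons] at h
      by_cases hb : b = a
      · subst hb
        cases s
        · exact List.mem_cons_self
        · exact List.mem_cons_of_mem _ (hneg (by simp at h; linarith))
      · exact List.mem_cons_of_mem _ (hneg (by simp [hb] at h; exact h))

/-- The tail of a closed word beginning with `m` contains `m̄`. [folklore] -/
private theorem flip_mem_of_netDisp_eq_zero (m : Letter P.d) (w : List (Letter P.d)) (h : netDisp (m :: w) m.1 = 0) :
    m.flip ∈ w := by
  obtain ⟨a, s⟩ := m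
  rw [netDisp_cons] at h
  simp only [if_true] at h
  cases s
  · exact (mem_of_netDisp_ne a w).1 (by simp at h; linarith)
  · exact (mem_of_netDisp_ne a w).2 (by simp at h; linarith)

/-- Removing a cancelling pair `m … m̄` keeps every net displacement. [folklore] -/
private theorem netDisp_remove_pair (m : Letter P.d) (B C : List (Letter P.d)) (ν : Fin P.d) :
    netDisp (m :: (B ++ m.flip :: C)) ν = netDisp (B ++ C) ν := by
  obtain ⟨a, s⟩ := m
  simp only [netDisp_cons, netDisp_append, Letter.flip]
  by_cases ha : a = ν
  · subst ha; cases s <;> simp <;> ring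
  · simp [ha]

/-- **THE CRUDE NON-ABELIAN LATTICE STOKES BOUND, LOCAL FORM.**  If every plaquette cornered at `walkEnd x u`, `|u| ≤ r`, is
within `δ ≥ 0` of `1`, then for every word `w` of length `n ≤ r` with zero net displacement in every direction,
`|𝒰_x(w) − 1| ≤ (n²/4)·δ` (the tree's induction: cancel the first letter against its partner, `(n − 2) + (n − 2)²/4 ≤ n²/4`;
every plaquette met is cornered within `n` letters of `x`). [cite: Balaban1985Averaging, (9) p.19 and (19)-(20) p.21] -/
theorem dist1_holAt_le_of_netDisp_eq_zero_loc {δ : ℝ} (hδ : 0 ≤ δ) {x : Site P j} {r : ℕ}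
    (hU : ∀ u : List (Letter P.d), u.length ≤ r → ∀ (a b : Fin P.d) (hab : a < b),
      dist1 (GaugeField.plaqHol U ⟨walkEnd x u, a, b, hab⟩) < δ) :
    ∀ (n : ℕ) (w : List (Letter P.d)), w.length = n → n ≤ r → (∀ ν, netDisp w ν = 0) →
      dist1 (holAt U (walk x w)) ≤ ((n : ℝ) ^ 2 / 4) * δ := by
  intro n
  induction n using Nat.strong_induction_on with
  | _ n ih =>
    intro w hlen hnr hnull
    cases w with
    | nil =>
      subst hlen
      simp only [walk, holAt_nil, GaugeGroup.dist1_one]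
      positivity
    | cons m w' =>
      have hmem : m.flip ∈ w' := flip_mem_of_netDisp_eq_zero m w' (hnull m.1)
      obtain ⟨B, C, hw'⟩ := List.append_of_mem hmem
      subst hw'
      simp only [List.length_cons, List.length_append] at hlen
      have hstep := dist1_holAt_cancel_le_loc U hδ hU m B [] C (by simp only [List.length_nil]; omega)
      simp only [List.nil_append] at hstep
      have hnull' : ∀ ν, netDisp (B ++ C) ν = 0 := fun ν => by rw [← netDisp_remove_pair m B C ν]; exact hnull ν
      have hlen' : (B ++ C).length = n - 2 := by simp; omega
      have h2n : 2 ≤ n := by omega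
      have ih' := ih (n - 2) (by omega) (B ++ C) hlen' (by omega) hnull'
      have hB : (B.length : ℝ) ≤ (n : ℝ) - 2 := by
        have h : (B.length : ℝ) + 2 ≤ n := by exact_mod_cast (show B.length + 2 ≤ n by omega)
        linarith
      have hcast : (((n - 2 : ℕ) : ℝ)) = (n : ℝ) - 2 := by rw [Nat.cast_sub h2n]; norm_num
      calc dist1 (holAt U (walk x (m :: (B ++ m.flip :: C))))
          ≤ (B.length : ℝ) * δ + dist1 (holAt U (walk x (B ++ C))) := hstep
        _ ≤ ((n : ℝ) - 2) * δ + ((((n - 2 : ℕ) : ℝ)) ^ 2 / 4) * δ := add_le_add (mul_le_mul_of_nonneg_right hB hδ) ih'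
        _ ≤ ((n : ℝ) ^ 2 / 4) * δ := by rw [hcast]; nlinarith

/-- The same bound stated with the word's own length (`|w| ≤ r`). [cite: Balaban1985Averaging, (9) p.19 and (19)-(20) p.21] -/
theorem dist1_holAt_le_loc {δ : ℝ} (hδ : 0 ≤ δ) {x : Site P j} {r : ℕ}
    (hU : ∀ u : List (Letter P.d), u.length ≤ r → ∀ (a b : Fin P.d) (hab : a < b),
      dist1 (GaugeField.plaqHol U ⟨walkEnd x u, a, b, hab⟩) < δ)
    (w : List (Letter P.d)) (hw : ∀ ν, netDisp w ν = 0) (hwr : w.length ≤ r) :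
    dist1 (holAt U (walk x w)) ≤ ((w.length : ℝ) ^ 2 / 4) * δ :=
  dist1_holAt_le_of_netDisp_eq_zero_loc U hδ hU w.length w rfl hwr hw

end Main

/-! ## §4 The (0.4) loop variables and the guard under the local hypothesis at the block centre -/

section LoopWords

open BlockAveraging

/-- **THE (0.4) LOOP VARIABLES OF A LOCALLY SMALL FIELD ARE SMALL**: if every plaquette cornered at `walkEnd (emb c₋) u`,
`|u| ≤ r`, `(d+2)L ≤ r`, is within `δ ≥ 0` of `1`, then every loop variable `U(Γ ∪ [x,x′] ∪ (−Γ′) ∪ (−c))` at the coarse bond `c`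
is within `(((d+2)L)²/4)·δ` of `1` (closed words of length `≤ (d+2)L` from `emb c₋`). [cite: Balaban1987RG1, (0.4) p.253] -/
theorem dist1_loopHol_le_loc {δ : ℝ} (hδ : 0 ≤ δ) {U : GaugeField P j G} (c : PBond P (j + 1)) {r : ℕ}
    (hr : (P.d + 2) * P.L ≤ r)
    (hU : ∀ u : List (Letter P.d), u.length ≤ r → ∀ (a b : Fin P.d) (hab : a < b),
      dist1 (GaugeField.plaqHol U ⟨walkEnd (emb c.src) u, a, b, hab⟩) < δ)
    (i : Idx P) :
    dist1 (loopHol U c i) ≤ ((((P.d + 2) * P.L : ℕ) : ℝ) ^ 2 / 4) * δ := by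
  have hlenN := length_loopWord_le c i
  have h := dist1_holAt_le_loc U hδ hU (loopWord P.L c.dir (off i.1) i.2.1 i.2.2) (netDisp_loopWord _ _ _ _ _)
    (hlenN.trans hr)
  refine h.trans (mul_le_mul_of_nonneg_right ?_ hδ)
  have hlen : ((loopWord P.L c.dir (off i.1) i.2.1 i.2.2).length : ℝ) ≤ (((P.d + 2) * P.L : ℕ) : ℝ) := by
    exact_mod_cast hlenN
  have h0 : (0 : ℝ) ≤ ((loopWord P.L c.dir (off i.1) i.2.1 i.2.2).length : ℝ) := Nat.cast_nonneg _
  nlinarith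

/-- **THE GUARD OF THE (0.4) AVERAGING IS INACTIVE ON LOCALLY SMALL FIELDS**: under the local hypothesis at `emb c₋` with radius
`r ≥ (d+2)L` and `(((d+2)L)²/4)·δ < δ_ℰ`, `BlockAveraging.Small ℰ U c`. [cite: Balaban1987RG1, (0.4) p.253] -/
theorem small_loc (ℰ : LoopAverage G) {δ : ℝ} (hδ : 0 ≤ δ) {U : GaugeField P j G} (c : PBond P (j + 1)) {r : ℕ}
    (hr : (P.d + 2) * P.L ≤ r)
    (hU : ∀ u : List (Letter P.d), u.length ≤ r → ∀ (a b : Fin P.d) (hab : a < b),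
      dist1 (GaugeField.plaqHol U ⟨walkEnd (emb c.src) u, a, b, hab⟩) < δ)
    (hδℰ : ((((P.d + 2) * P.L : ℕ) : ℝ) ^ 2 / 4) * δ < ℰ.δ) : Small ℰ U c :=
  fun i => (dist1_loopHol_le_loc hδ c hr hU i).trans_lt hδℰ

end LoopWords

end Summit.QuantumFields.YangMills.Theorems.LocalWordStokes
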